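import Literature.NumberTheory.LFunctions.RobinLiThetaOscillation
import Literature.NumberTheory.LFunctions.NicolasJ
import Literature.NumberTheory.LFunctions.VonKochTheorem
import HarnessLib

/-!
# RH-EQUIVALENT — Robin 1984, Thm. 1 PROVED: `RH ⟺ A(x) = li(θ(x)) − π(x) > 0 for all large x`

RH-CONDITIONAL (`RH ⟹ A(x) > 0` eventually, Robin's "easy" half) and RH-EQUIVALENT (Robin 1984,
Thm. 1, now a theorem of the tree: `Literature.NumberTheory.LFunctions.riemannHypothesis_iff_eventually_liThetaSubPi_pos`);
nothing here bears on the truth of RH — an implication from RH and an equivalence are proved,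
neither side is asserted. Literature-typing tranche 1 (Broughan, *Equivalents of the Riemann
Hypothesis* vol. 3, Ch. 1, Nicolas' `li(θ(x)) − π(x)` criterion; G. Robin, Ann. Fac. Sci. Toulouse (5)
6 (1984) 257–268, Thm. 1: "L'assertion `A(x) = Li(θ(x)) − π(x) > 0` pour `x` assez grand est
équivalente à l'hypothèse de Riemann. Lorsque l'hypothèse de Riemann est vraie, il est facile de
déduire de calculs faits par Ramanujan ([RAM], p. 119) que `A(x) > 0`, pour `x` assez grand").

The `⟸` half (`A > 0` eventually `⟹` RH) is the tree's
`riemannHypothesis_of_eventually_liThetaSubPi_pos` (`RobinLiThetaOscillation.lean`, from Robin's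
Lemma 2). This file proves the `⟹` half, **`RH ⟹ A(x) > 0` for all large `x`**
(`Literature.NumberTheory.LFunctions.eventually_liThetaSubPi_pos_of_riemannHypothesis`), along
Robin's decomposition (§4 (13), the tree's `RobinLiTheta.liThetaSubPi_eq_robinD_add`)

  `A(x) = D(x) + li 2 + P(x) − gap(x)`,  `D = (ψ − x)/log x − (Π − li)`,
  `P(x) = (Π(x) − π(x)) − (ψ(x) − θ(x))/log x = ∑_{p^k ≤ x, k ≥ 2} (1/k − log p/log x) ≥ 0`,
  `0 ≤ gap(x) = (θ(x) − x)/log x − (li θ(x) − li x) ≤ (θ(x) − x)²/(u log² u)`: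

* `P(x) ≥ π(√x/e)/log x` (keep only the squares `p² ≤ x/e²`, each contributing `≥ 1/log x`;
  `LiThetaRH.primeCounting_div_log_le_posPart`), hence under RH, by von Koch's theorem (the tree's
  PROVED `vonKoch_chebyshevPsi_of_riemannHypothesis_holds`, `ψ(x) − x = O(√x log² x)`, so
  `|θ(y) − y| ≤ K√y log² y`) and `θ(y) ≤ π(y) log y`, `P(x) ≥ (2/e)√x/log² x − O(x^{1/4})`;
* `D(x) = O(0.21 √x/log² x)` under RH (`LiThetaRH.abs_robinD_le_of_RH`): the function
  `F = D + R·w`, `R = ψ₁ − t²/2`, `w = 1/(t log² t)`, has right derivative `R w'` (the tree's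
  `RobinLiTheta.hasDerivWithinAt_robinD`, `D' = (t − ψ)w`, against `R' = ψ − t`), and under RH
  `|R(t)| ≤ β t^{3/2} + t log 2π + O(√t) ≤ 0.05 t^{3/2}` for large `t` by the tree's explicit
  formula for `ψ₁` (`norm_psiOne_sub_le_of_RH`, `β = nicolasBeta < 0.0474`, MV (13.8)), so
  `|F'| ≤ 0.04 (4√t/log² t)'` and the right-derivative comparison principle
  (`image_le_of_deriv_right_le_deriv_boundary`) bounds `F`, whence `D = F − R w`;
* `gap(x) ≤ 8K² log² x` under RH (`u = x/2`).

So `A(x) ≥ 0.52 √x/log² x − O(x^{1/4}) − O(log² x) − O(1) > 0` for all large `x`. (Robin's own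
route is via Ramanujan's computation; Nicolas 2017, Thm. 1.1 gives the sharp constants `2 ± β`, which
we do not reach — the tree keeps them as the named fact `Nicolas2017_thm1_1`.) With the `⟸` half:
**`RH ⟺ ∀ᶠ x, A(x) > 0`** unconditionally, and Nicolas's `x ≥ 11` form stays over `Nicolas2017_thm1_1`.

## References

* G. Robin, *Sur la différence `Li(θ(x)) − π(x)`*, Ann. Fac. Sci. Toulouse (5) 6 (1984) 257–268,
  Thm. 1 (p. 257), §4 (13) [corpus:paper:doi-10-5802-afst-611 p0003, p0009–p0012]. [Robin1984Toulouse]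
* J.-L. Nicolas, *Estimates of `li(θ(x)) − π(x)` and the Riemann hypothesis*, in: Analytic Number
  Theory, Modular Forms and q-Hypergeometric Series, Springer 2017 (arXiv:1605.09297), Thm. 1.1,
  Cor. 1.1. [Nicolas2017]
* H. L. Montgomery, R. C. Vaughan, *Multiplicative Number Theory I*, CUP 2007, (13.6)–(13.8). [MontgomeryVaughan2007]
* H. von Koch, *Sur la distribution des nombres premiers*, Acta Math. 24 (1901) 159–182
  (`ψ(x) = x + O(√x log² x)` under RH; MV Thm. 13.1). [Koch1901]
* K. Broughan, *Equivalents of the Riemann Hypothesis. Vol. 3: Further Steps towards Resolving the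
  Riemann Hypothesis*, CUP 2023, Ch. 1. [Broughan2023Further]
-/

noncomputable section

open Real Filter Set Topology
open scoped Chebyshev

namespace Literature.NumberTheory.LFunctions

namespace LiThetaRH

open RobinLiTheta

/-! ### §1. `ψ₁` and `θ` under RH

Continuity of `ψ₁` and its right derivative `ψ` are the tree's `NicolasJ.continuous_psiOne`,
`NicolasJ.hasDerivWithinAt_psiOne` (MV (13.6)). -/

/-- **von Koch for `θ`, under RH**: there are `K > 0` and `X ≥ 3` with `|θ(x) − x| ≤ K √x log² x`
for `x ≥ X` (the tree's `vonKoch_chebyshevPsi_of_riemannHypothesis_holds` for `ψ`, and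
`|ψ − θ| ≤ 2√x log x`). [cite: Koch1901, Théorème (MV Thm. 13.1)] -/
theorem exists_abs_theta_sub_le_of_RH (hRH : RiemannHypothesis) :
    ∃ K X : ℝ, 0 < K ∧ 3 ≤ X ∧ ∀ x : ℝ, X ≤ x → |θ x - x| ≤ K * Real.sqrt x * Real.log x ^ 2 := by
  have hO := vonKoch_chebyshevPsi_of_riemannHypothesis_holds hRH
  obtain ⟨c, hc0, hc⟩ := hO.exists_pos
  rw [Asymptotics.isBigOWith_iff, eventually_atTop] at hc
  obtain ⟨X₀, hX₀⟩ := hc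
  refine ⟨c + 2, max X₀ 3, by linarith, le_max_right _ _, fun x hx => ?_⟩
  have hx3 : (3 : ℝ) ≤ x := (le_max_right _ _).trans hx
  have hx1 : (1 : ℝ) ≤ x := by linarith
  have hx0 : 0 < x := by linarith
  have hlog1 : 1 ≤ Real.log x := by
    rw [Real.le_log_iff_exp_le hx0]
    exact le_trans Real.exp_one_lt_d9.le (by linarith)
  have h1 := hX₀ x ((le_max_left _ _).trans hx)
  have hnn : 0 ≤ x ^ (1 / 2 : ℝ) * Real.log x ^ 2 := by positivity
  rw [Real.norm_eq_abs, Real.norm_eq_abs, abs_of_nonneg hnn, ← Real.sqrt_eq_rpow] at h1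
  have h2 := Chebyshev.abs_psi_sub_theta_le_sqrt_mul_log hx1
  have h3 : |θ x - x| ≤ |ψ x - x| + |ψ x - θ x| := by
    have := abs_sub (ψ x - x) (ψ x - θ x)
    rw [show ψ x - x - (ψ x - θ x) = θ x - x by ring] at this
    exact this
  have h4 : 2 * Real.sqrt x * Real.log x ≤ 2 * Real.sqrt x * Real.log x ^ 2 := by
    have : Real.log x ≤ Real.log x ^ 2 := by nlinarith
    exact mul_le_mul_of_nonneg_left this (by positivity)
  calc |θ x - x| ≤ |ψ x - x| + |ψ x - θ x| := h3
    _ ≤ c * (Real.sqrt x * Real.log x ^ 2) + 2 * Real.sqrt x * Real.log x := add_le_add h1 h2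
    _ ≤ (c + 2) * Real.sqrt x * Real.log x ^ 2 := by nlinarith

/-! ### §2. Under RH: `|ψ₁(t) − t²/2| ≤ 0.05 t^{3/2}` for large `t` (MV (13.8)) -/

/-- `R(t) = ψ₁(t) − t²/2`. [cite: MontgomeryVaughan2007, (13.8)] -/
def psiOneErr (t : ℝ) : ℝ := psiOne t - t ^ 2 / 2

/-- Under RH there is `T ≥ 2` with `|ψ₁(t) − t²/2| ≤ 0.05 t^{3/2}` for `t ≥ T` (from
`|ψ₁(t) − t²/2 + t log 2π − E(t)| ≤ β t^{3/2}`, `β < 0.0474`, `|E(t)| ≤ C√t`, `log 2π < 2`).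
[cite: MontgomeryVaughan2007, (13.8)] -/
theorem exists_abs_psiOneErr_le_of_RH (hRH : RiemannHypothesis) :
    ∃ T : ℝ, 2 ≤ T ∧ ∀ t : ℝ, T ≤ t → |psiOneErr t| ≤ 0.05 * t ^ (3 / 2 : ℝ) := by
  obtain ⟨C, hC0, hC⟩ := exists_norm_psiOneRemainder_le
  have hβ := nicolasBeta_lt'
  have hl2 : Real.log (2 * π) < 2 := by
    rw [Real.log_lt_iff_lt_exp (by positivity)]
    have h1 := Real.exp_one_gt_d9
    have h2 : Real.exp 2 = Real.exp 1 * Real.exp 1 := by rw [← Real.exp_add]; norm_num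
    nlinarith [Real.pi_lt_d2]
  have hl0 : 0 ≤ Real.log (2 * π) := Real.log_nonneg (by linarith [Real.pi_gt_three])
  refine ⟨max 2 (((2 + C) / 0.0026) ^ 2), le_max_left _ _, fun t ht => ?_⟩
  have ht2 : 2 ≤ t := (le_max_left _ _).trans ht
  have ht1 : 1 ≤ t := by linarith
  have ht0 : 0 < t := by linarith
  -- the three pieces
  have hmain := norm_psiOne_sub_le_of_RH hRH ht1
  have hE := hC t ht0
  have hlog : ‖(t : ℂ) * Complex.log (2 * π)‖ = t * Real.log (2 * π) := by
    rw [show (2 * π : ℂ) = ((2 * π : ℝ) : ℂ) by push_cast; rfl, ← Complex.ofReal_log (by positivity),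
      ← Complex.ofReal_mul, Complex.norm_real, Real.norm_eq_abs, abs_of_nonneg (by positivity)]
  have hR : |psiOneErr t| = ‖(psiOne t : ℂ) - (t : ℂ) ^ 2 / 2‖ := by
    rw [show (psiOne t : ℂ) - (t : ℂ) ^ 2 / 2 = ((psiOne t - t ^ 2 / 2 : ℝ) : ℂ) by push_cast; ring,
      Complex.norm_real, Real.norm_eq_abs, psiOneErr]
  have htri : ‖(psiOne t : ℂ) - (t : ℂ) ^ 2 / 2‖ ≤
      nicolasBeta * t ^ (3 / 2 : ℝ) + t * Real.log (2 * π) + C * Real.sqrt t := by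
    have e : (psiOne t : ℂ) - (t : ℂ) ^ 2 / 2 =
        ((psiOne t : ℂ) - (t : ℂ) ^ 2 / 2 + t * Complex.log (2 * π) - psiOneRemainder t) -
          (t : ℂ) * Complex.log (2 * π) + psiOneRemainder t := by ring
    rw [e]
    refine (norm_add_le _ _).trans (add_le_add ((norm_sub_le _ _).trans (add_le_add hmain ?_)) hE)
    rw [hlog]
  -- `2t + C√t ≤ 0.0026 t^{3/2}` for `t ≥ ((2+C)/0.0026)²`
  have hsq : (2 + C) / 0.0026 ≤ Real.sqrt t := by
    rw [Real.le_sqrt (by positivity) ht0.le]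
    exact (le_max_right _ _).trans ht
  have hst : Real.sqrt t ≤ t := by
    rw [Real.sqrt_le_left] <;> nlinarith
  have h32 : t ^ (3 / 2 : ℝ) = t * Real.sqrt t := by
    rw [Real.sqrt_eq_rpow, show (3 / 2 : ℝ) = 1 + 1 / 2 by norm_num, Real.rpow_add ht0, Real.rpow_one]
  rw [hR]
  refine htri.trans ?_
  rw [h32]
  have hs0 : 0 ≤ Real.sqrt t := Real.sqrt_nonneg t
  have k1 : nicolasBeta * (t * Real.sqrt t) ≤ 0.0474 * (t * Real.sqrt t) :=
    mul_le_mul_of_nonneg_right hβ.le (by positivity)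
  have k2 : t * Real.log (2 * π) ≤ 2 * t := by nlinarith
  have k3 : C * Real.sqrt t ≤ C * t := mul_le_mul_of_nonneg_left hst hC0.le
  have k4 : (2 + C) * t ≤ 0.0026 * Real.sqrt t * t := by
    have : 2 + C ≤ 0.0026 * Real.sqrt t := by
      rw [div_le_iff₀ (by norm_num)] at hsq; linarith
    exact mul_le_mul_of_nonneg_right this ht0.le
  nlinarith [k1, k2, k3, k4]

/-! ### §3. `F = D + R·w` has right derivative `R·w'` -/

/-- The weight `w(t) = 1/(t log² t)` (the derivative of `D` is `(t − ψ(t)) w(t)`, Robin (15)).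
[cite: Robin1984Toulouse, §4 (15)] -/
def wt (t : ℝ) : ℝ := (t * Real.log t ^ 2)⁻¹

/-- `w'(t) = −(log t + 2)/(t² log³ t)`. [cite: Robin1984Toulouse, §4 (15)] -/
def wtDeriv (t : ℝ) : ℝ := -(Real.log t + 2) / (t ^ 2 * Real.log t ^ 3)

/-- `w' = wtDeriv` for `t > 1`. [cite: Robin1984Toulouse, §4 (15)] -/
theorem hasDerivAt_wt {t : ℝ} (ht : 1 < t) : HasDerivAt wt (wtDeriv t) t := by
  have ht0 : t ≠ 0 := by linarith
  have hlog : Real.log t ≠ 0 := (Real.log_pos ht).ne'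
  have h1 : HasDerivAt (fun u : ℝ ↦ u * Real.log u ^ 2)
      (1 * Real.log t ^ 2 + t * (2 * Real.log t ^ 1 * t⁻¹)) t :=
    (hasDerivAt_id' t).mul ((Real.hasDerivAt_log ht0).pow 2)
  have hne : t * Real.log t ^ 2 ≠ 0 := mul_ne_zero ht0 (pow_ne_zero _ hlog)
  have h := h1.inv hne
  refine h.congr_deriv ?_
  rw [wtDeriv]
  field_simp

/-- Robin's `D` corrected by `R w`: `F(t) = D(t) + (ψ₁(t) − t²/2)/(t log² t)`.
[cite: Robin1984Toulouse, §4 (13), (15)] -/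
def robinF (t : ℝ) : ℝ := robinD t + psiOneErr t * wt t

/-- **`F'₊ = R w'`**: the terms `(t − ψ)w` of `D'` and `(ψ − t)w` of `(Rw)'` cancel (`t ≥ 2`).
[cite: Robin1984Toulouse, §4 (15)] -/
theorem hasDerivWithinAt_robinF {t : ℝ} (ht : 2 ≤ t) :
    HasDerivWithinAt robinF (psiOneErr t * wtDeriv t) (Ioi t) t := by
  have ht1 : 1 < t := by linarith
  have ht0 : t ≠ 0 := by linarith
  have hlog : Real.log t ≠ 0 := (Real.log_pos ht1).ne'
  have hD := hasDerivWithinAt_robinD ht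
  have hR : HasDerivWithinAt psiOneErr (ψ t - t) (Ioi t) t := by
    have h2 : HasDerivWithinAt (fun u : ℝ ↦ u ^ 2 / 2) t (Ioi t) t := by
      have h := (hasDerivAt_pow 2 t).div_const 2
      simp only [Nat.cast_ofNat, Nat.reduceSub, pow_one] at h
      refine (h.hasDerivWithinAt (s := Ioi t)).congr_deriv ?_
      ring
    exact (NicolasJ.hasDerivWithinAt_psiOne t).sub h2
  have hw := (hasDerivAt_wt ht1).hasDerivWithinAt (s := Ioi t)
  have h := hD.add (hR.mul hw)
  refine h.congr_deriv ?_
  rw [wt]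
  field_simp
  ring

/-- `F` is continuous on `[2, ∞)`. [cite: Robin1984Toulouse, §4 (proof of Lemme 2)] -/
theorem continuousOn_robinF : ContinuousOn robinF (Ici 2) := by
  refine continuousOn_robinD.add ?_
  refine ((NicolasJ.continuous_psiOne.sub ((continuous_pow 2).div_const 2)).continuousOn).mul ?_
  refine ContinuousOn.inv₀ (continuousOn_id.mul ((Real.continuousOn_log.mono ?_).pow 2)) ?_
  · intro t ht; simp only [mem_Ici] at ht; simp; linarith
  · intro t ht
    simp only [mem_Ici] at ht
    exact mul_ne_zero (by linarith) (pow_ne_zero _ (Real.log_pos (by linarith)).ne')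

/-! ### §4. The comparison function `h(t) = 4√t/log² t` and the bound on `D` under RH -/

/-- `h(t) = 4√t/log² t`. [folklore] -/
def hcmp (t : ℝ) : ℝ := 4 * Real.sqrt t / Real.log t ^ 2

/-- `h'(t) = (2 log t − 8)/(√t log³ t)`. [folklore] -/
def hcmpDeriv (t : ℝ) : ℝ := (2 * Real.log t - 8) / (Real.sqrt t * Real.log t ^ 3)

/-- `h' = hcmpDeriv` for `t > 1`. [cite: Robin1984Toulouse, §4 (15)] -/
theorem hasDerivAt_hcmp {t : ℝ} (ht : 1 < t) : HasDerivAt hcmp (hcmpDeriv t) t := by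
  have ht0 : 0 < t := by linarith
  have hlog : Real.log t ≠ 0 := (Real.log_pos ht).ne'
  have hs : Real.sqrt t ≠ 0 := (Real.sqrt_pos.2 ht0).ne'
  have h1 : HasDerivAt (fun u : ℝ ↦ 4 * Real.sqrt u) (4 * (1 / (2 * Real.sqrt t))) t :=
    (Real.hasDerivAt_sqrt ht0.ne').const_mul 4
  have h2 : HasDerivAt (fun u : ℝ ↦ Real.log u ^ 2) (2 * Real.log t ^ 1 * t⁻¹) t :=
    (Real.hasDerivAt_log ht0.ne').pow 2
  have h := h1.div h2 (pow_ne_zero _ hlog)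
  refine h.congr_deriv ?_
  have hst : Real.sqrt t * Real.sqrt t = t := Real.mul_self_sqrt ht0.le
  rw [hcmpDeriv]
  field_simp
  nlinarith [hst]

/-- The derivative bound: for `log t ≥ 16` and `|R(t)| ≤ 0.05 t^{3/2}`,
`|R(t) w'(t)| ≤ 0.04 h'(t)`. [cite: Robin1984Toulouse, §4 (15)] -/
theorem abs_mul_wtDeriv_le {t : ℝ} (ht : Real.exp 16 ≤ t) (hR : |psiOneErr t| ≤ 0.05 * t ^ (3 / 2 : ℝ)) :
    |psiOneErr t * wtDeriv t| ≤ 0.04 * hcmpDeriv t := by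
  have ht0 : 0 < t := lt_of_lt_of_le (Real.exp_pos 16) ht
  have hL : 16 ≤ Real.log t := by
    rw [Real.le_log_iff_exp_le ht0]; exact ht
  have hs0 : 0 < Real.sqrt t := Real.sqrt_pos.2 ht0
  have hst : Real.sqrt t * Real.sqrt t = t := Real.mul_self_sqrt ht0.le
  have h32 : t ^ (3 / 2 : ℝ) = t * Real.sqrt t := by
    rw [Real.sqrt_eq_rpow, show (3 / 2 : ℝ) = 1 + 1 / 2 by norm_num, Real.rpow_add ht0, Real.rpow_one]
  rw [h32] at hR
  have hw : |wtDeriv t| = (Real.log t + 2) / (t ^ 2 * Real.log t ^ 3) := by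
    rw [wtDeriv, abs_div, abs_neg, abs_of_nonneg (by positivity), abs_of_nonneg (by positivity)]
  rw [abs_mul, hw, hcmpDeriv]
  -- `|R| (log t + 2)/(t² log³ t) ≤ 0.05 t√t (log t + 2)/(t² log³ t) ≤ 0.04 (2 log t − 8)/(√t log³ t)`
  have hlog3 : 0 < Real.log t ^ 3 := by positivity
  calc |psiOneErr t| * ((Real.log t + 2) / (t ^ 2 * Real.log t ^ 3))
      ≤ 0.05 * (t * Real.sqrt t) * ((Real.log t + 2) / (t ^ 2 * Real.log t ^ 3)) :=
        mul_le_mul_of_nonneg_right hR (by positivity)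
    _ = 0.05 * (Real.log t + 2) / (Real.sqrt t * Real.log t ^ 3) := by
        rw [mul_div_assoc', div_eq_div_iff (by positivity) (by positivity)]
        linear_combination (0.05 * (Real.log t + 2) * Real.log t ^ 3 * t) * hst
    _ ≤ 0.04 * ((2 * Real.log t - 8) / (Real.sqrt t * Real.log t ^ 3)) := by
        rw [mul_div_assoc']
        refine div_le_div_of_nonneg_right ?_ (by positivity)
        nlinarith

/-- **`|F(x) − F(x₁)| ≤ 0.04 (h(x) − h(x₁))`** for `x₁ ≤ x`, once `x₁ ≥ e^{16}` lies beyond the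
threshold `T` of `exists_abs_psiOneErr_le_of_RH` (right-derivative comparison principle).
[cite: Robin1984Toulouse, §4 (15)–(16)] -/
theorem abs_robinF_sub_le {T x₁ x : ℝ} (hT : ∀ t : ℝ, T ≤ t → |psiOneErr t| ≤ 0.05 * t ^ (3 / 2 : ℝ))
    (hx₁T : T ≤ x₁) (hx₁ : Real.exp 16 ≤ x₁) (hx : x₁ ≤ x) :
    |robinF x - robinF x₁| ≤ 0.04 * (hcmp x - hcmp x₁) := by
  have he : (2 : ℝ) ≤ Real.exp 16 := by
    have := Real.add_one_le_exp (16 : ℝ); linarith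
  have hx₁2 : 2 ≤ x₁ := he.trans hx₁
  -- common data on `[x₁, x]`
  have hFc : ContinuousOn robinF (Icc x₁ x) := continuousOn_robinF.mono fun t ht => hx₁2.trans ht.1
  have hFd : ∀ t ∈ Ico x₁ x, HasDerivWithinAt robinF (psiOneErr t * wtDeriv t) (Ici t) t :=
    fun t ht => hasDerivWithinAt_Ioi_iff_Ici.1 (hasDerivWithinAt_robinF (hx₁2.trans ht.1))
  have hhc : ContinuousOn hcmp (Icc x₁ x) := fun t ht =>
    (hasDerivAt_hcmp (by linarith [ht.1] : (1 : ℝ) < t)).continuousAt.continuousWithinAt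
  have hbd : ∀ t ∈ Ico x₁ x, |psiOneErr t * wtDeriv t| ≤ 0.04 * hcmpDeriv t := fun t ht =>
    abs_mul_wtDeriv_le (hx₁.trans ht.1) (hT t (hx₁T.trans ht.1))
  -- upper bound for `F`
  have hB : ∀ t ∈ Ico x₁ x, HasDerivWithinAt (fun u ↦ robinF x₁ + 0.04 * (hcmp u - hcmp x₁))
      (0.04 * hcmpDeriv t) (Ici t) t := by
    intro t ht
    have := (((hasDerivAt_hcmp (by linarith [ht.1] : (1 : ℝ) < t)).sub_const (hcmp x₁)).const_mul
      (0.04 : ℝ)).const_add (robinF x₁)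
    exact this.hasDerivWithinAt
  have hBc : ContinuousOn (fun u ↦ robinF x₁ + 0.04 * (hcmp u - hcmp x₁)) (Icc x₁ x) :=
    continuousOn_const.add (continuousOn_const.mul (hhc.sub continuousOn_const))
  have hup := image_le_of_deriv_right_le_deriv_boundary hFc hFd (B := fun u ↦ robinF x₁ +
      0.04 * (hcmp u - hcmp x₁)) (by simp) hBc hB (fun t ht => (le_abs_self _).trans (hbd t ht))
    (right_mem_Icc.2 hx)
  -- lower bound for `F` (apply the principle to `−F`)
  have hFc' : ContinuousOn (fun u ↦ -robinF u) (Icc x₁ x) := hFc.neg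
  have hFd' : ∀ t ∈ Ico x₁ x, HasDerivWithinAt (fun u ↦ -robinF u) (-(psiOneErr t * wtDeriv t))
      (Ici t) t := fun t ht => (hFd t ht).neg
  have hB' : ∀ t ∈ Ico x₁ x, HasDerivWithinAt (fun u ↦ -robinF x₁ + 0.04 * (hcmp u - hcmp x₁))
      (0.04 * hcmpDeriv t) (Ici t) t := by
    intro t ht
    have := (((hasDerivAt_hcmp (by linarith [ht.1] : (1 : ℝ) < t)).sub_const (hcmp x₁)).const_mul
      (0.04 : ℝ)).const_add (-robinF x₁)
    exact this.hasDerivWithinAt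
  have hBc' : ContinuousOn (fun u ↦ -robinF x₁ + 0.04 * (hcmp u - hcmp x₁)) (Icc x₁ x) :=
    continuousOn_const.add (continuousOn_const.mul (hhc.sub continuousOn_const))
  have hlow := image_le_of_deriv_right_le_deriv_boundary hFc' hFd' (B := fun u ↦ -robinF x₁ +
      0.04 * (hcmp u - hcmp x₁)) (by simp) hBc' hB'
    (fun t ht => (neg_le_abs _).trans (hbd t ht)) (right_mem_Icc.2 hx)
  rw [abs_le]
  constructor <;> linarith

/-- **`D` under RH**: there are `x₁` and `C` with `|D(x)| ≤ C + 0.21 √x/log² x` for all `x ≥ x₁`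
(`D = F − R w`, `|F(x) − F(x₁)| ≤ 0.04 h(x) = 0.16 √x/log² x`, `|R w| ≤ 0.05 √x/log² x`).
[cite: Robin1984Toulouse, §4 (13)–(16)] -/
theorem abs_robinD_le_of_RH (hRH : RiemannHypothesis) :
    ∃ x₁ C : ℝ, Real.exp 16 ≤ x₁ ∧ ∀ x : ℝ, x₁ ≤ x →
      |robinD x| ≤ C + 0.21 * (Real.sqrt x / Real.log x ^ 2) := by
  obtain ⟨T, hT2, hT⟩ := exists_abs_psiOneErr_le_of_RH hRH
  set x₁ : ℝ := max T (Real.exp 16) with hx₁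
  refine ⟨x₁, |robinF x₁|, le_max_right _ _, fun x hx => ?_⟩
  have hx₁e : Real.exp 16 ≤ x₁ := le_max_right _ _
  have hx0 : 0 < x := lt_of_lt_of_le (Real.exp_pos 16) (hx₁e.trans hx)
  have hF := abs_robinF_sub_le hT (le_max_left _ _) hx₁e hx
  have hR := hT x ((le_max_left _ _).trans hx)
  have hs0 : 0 < Real.sqrt x := Real.sqrt_pos.2 hx0
  have hst : Real.sqrt x * Real.sqrt x = x := Real.mul_self_sqrt hx0.le
  have hlog : 0 < Real.log x := by
    have : 16 ≤ Real.log x := by rw [Real.le_log_iff_exp_le hx0]; exact hx₁e.trans hx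
    linarith
  have h32 : x ^ (3 / 2 : ℝ) = x * Real.sqrt x := by
    rw [Real.sqrt_eq_rpow, show (3 / 2 : ℝ) = 1 + 1 / 2 by norm_num, Real.rpow_add hx0, Real.rpow_one]
  rw [h32] at hR
  -- `D x = F x − R x · w x`
  have hD : robinD x = robinF x - psiOneErr x * wt x := by rw [robinF]; ring
  have hRw : |psiOneErr x * wt x| ≤ 0.05 * (Real.sqrt x / Real.log x ^ 2) := by
    rw [abs_mul, wt, abs_inv, abs_of_pos (mul_pos hx0 (pow_pos hlog 2))]
    calc |psiOneErr x| * (x * Real.log x ^ 2)⁻¹ ≤ 0.05 * (x * Real.sqrt x) * (x * Real.log x ^ 2)⁻¹ :=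
          mul_le_mul_of_nonneg_right hR (by positivity)
      _ = 0.05 * (Real.sqrt x / Real.log x ^ 2) := by field_simp
  have hh0 : 0 ≤ hcmp x₁ := by rw [hcmp]; positivity
  have hhx : hcmp x = 4 * (Real.sqrt x / Real.log x ^ 2) := by rw [hcmp]; ring
  rw [hD]
  have h1 : |robinF x| ≤ |robinF x₁| + 0.04 * (hcmp x - hcmp x₁) := by
    have := abs_sub_abs_le_abs_sub (robinF x) (robinF x₁); linarith
  calc |robinF x - psiOneErr x * wt x| ≤ |robinF x| + |psiOneErr x * wt x| := abs_sub _ _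
    _ ≤ |robinF x₁| + 0.04 * (hcmp x - hcmp x₁) + 0.05 * (Real.sqrt x / Real.log x ^ 2) :=
        add_le_add h1 hRw
    _ ≤ |robinF x₁| + 0.21 * (Real.sqrt x / Real.log x ^ 2) := by rw [hhx]; nlinarith

/-! ### §5. The positive term `P(x) = (Π − π) − (ψ − θ)/log x ≥ π(√x/e)/log x` -/

/-- `P(x) = (Π(x) − π(x)) − (ψ(x) − θ(x))/log x = ∑_{p^k ≤ x, k ≥ 2} (1/k − log p/log x)`, the
prime-power part of `A − D` (Robin (13): `B = D + O(x^{2Θ−1})` keeps it inside the `O`).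
[cite: Robin1984Toulouse, §4 (13)] -/
def posPart (x : ℝ) : ℝ :=
  primePi x - (Nat.primeCounting ⌊x⌋₊ : ℝ) - (ψ x - θ x) / Real.log x

/-- `A = D + li 2 + P − gap` (the tree's `liThetaSubPi_eq_robinD_add`, regrouped).
[cite: Robin1984Toulouse, §4 (13)] -/
theorem liThetaSubPi_eq_posPart {x : ℝ} (hx : 2 ≤ x) :
    liThetaSubPi x = robinD x + logIntegral 2 + posPart x -
      ((θ x - x) / Real.log x - (logIntegral (θ x) - logIntegral x)) := by
  rw [liThetaSubPi_eq_robinD_add hx, posPart]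
  ring

/-- `π(N) = ∑_{0 < n ≤ N} [n prime]` (as a real sum). [folklore] -/
private theorem primeCounting_eq_sum (N : ℕ) :
    (Nat.primeCounting N : ℝ) = ∑ n ∈ Finset.Ioc 0 N, if n.Prime then (1 : ℝ) else 0 := by
  have hset : (Finset.Ioc 0 N).filter Nat.Prime = Nat.primesLE N := by
    ext p
    simp only [Finset.mem_filter, Finset.mem_Ioc, Nat.mem_primesLE]
    constructor
    · rintro ⟨⟨-, h2⟩, hp⟩; exact ⟨h2, hp⟩
    · rintro ⟨h1, hp⟩; exact ⟨⟨hp.pos, h1⟩, hp⟩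
  rw [← Finset.sum_filter, hset, Finset.sum_const, nsmul_eq_mul, mul_one,
    Nat.primesLE_card_eq_primeCounting]

/-- `θ(x) = ∑_{0 < n ≤ ⌊x⌋} [n prime] log n`. [folklore] -/
private theorem theta_eq_sum_ite (x : ℝ) :
    θ x = ∑ n ∈ Finset.Ioc 0 ⌊x⌋₊, if n.Prime then Real.log n else 0 := by
  rw [Chebyshev.theta, Finset.sum_filter]

/-- The summand `g(n) = (Λ(n)/log n − [n prime])(1 − log n/log x)` (`= 1/k − log p/log x` at
`n = p^k`, `k ≥ 2`, and `0` otherwise). [cite: Robin1984Toulouse, §4 (13)] -/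
def gTerm (x : ℝ) (n : ℕ) : ℝ :=
  ((ArithmeticFunction.vonMangoldt n : ℝ) / Real.log n - if n.Prime then 1 else 0) *
    (1 - Real.log n / Real.log x)

/-- `P(x) = ∑_{0 < n ≤ x} g(n)`. [cite: Robin1984Toulouse, §4 (13)] -/
theorem posPart_eq_sum (x : ℝ) : posPart x = ∑ n ∈ Finset.Ioc 0 ⌊x⌋₊, gTerm x n := by
  rw [posPart, primePi, primeCounting_eq_sum, Chebyshev.psi, theta_eq_sum_ite, sub_div,
    Finset.sum_div, Finset.sum_div, ← Finset.sum_sub_distrib, ← Finset.sum_sub_distrib,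
    ← Finset.sum_sub_distrib]
  refine Finset.sum_congr rfl fun n hn => ?_
  have hn1 : 1 ≤ n := (Finset.mem_Ioc.1 hn).1
  rw [gTerm]
  split_ifs with hp
  · rw [ArithmeticFunction.vonMangoldt_apply_prime hp]
    have hl : Real.log n ≠ 0 := (Real.log_pos (by exact_mod_cast hp.one_lt)).ne'
    field_simp
  · rcases hn1.eq_or_lt with h | h
    · rw [← h]; simp [ArithmeticFunction.vonMangoldt_apply_one]
    · have hl : Real.log n ≠ 0 := (Real.log_pos (by exact_mod_cast h)).ne'
      field_simp
      ring

/-- `g(n) ≥ 0` for `0 < n ≤ x`. [cite: Robin1984Toulouse, §4 (13)] -/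
theorem gTerm_nonneg {x : ℝ} (hx : 1 < x) {n : ℕ} (hn : n ∈ Finset.Ioc 0 ⌊x⌋₊) : 0 ≤ gTerm x n := by
  have hn' := Finset.mem_Ioc.1 hn
  have hn0 : (0 : ℝ) < n := by exact_mod_cast hn'.1
  have hnx : (n : ℝ) ≤ x := (Nat.le_floor_iff' (by omega)).1 hn'.2
  have hlogx : 0 < Real.log x := Real.log_pos hx
  have h2 : 0 ≤ 1 - Real.log n / Real.log x := by
    rw [sub_nonneg, div_le_one hlogx]
    exact Real.log_le_log hn0 hnx
  rw [gTerm]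
  refine mul_nonneg ?_ h2
  split_ifs with hp
  · rw [ArithmeticFunction.vonMangoldt_apply_prime hp,
      div_self (Real.log_pos (by exact_mod_cast hp.one_lt)).ne', sub_self]
  · rw [sub_zero]
    exact div_nonneg ArithmeticFunction.vonMangoldt_nonneg (Real.log_nonneg (by exact_mod_cast hn'.1))

/-- At a prime square `p² ≤ x/e²`: `g(p²) = (1 − 2 log p/log x)/2 ≥ 1/log x`.
[cite: Robin1984Toulouse, §4 (13)] -/
theorem inv_log_le_gTerm_sq {x : ℝ} (hx : 1 < x) {p : ℕ} (hp : p.Prime)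
    (hpx : ((p : ℝ) ^ 2) * Real.exp 2 ≤ x) : (Real.log x)⁻¹ ≤ gTerm x (p ^ 2) := by
  have hlogx : 0 < Real.log x := Real.log_pos hx
  have hp1 : (1 : ℝ) < p := by exact_mod_cast hp.one_lt
  have hlp : 0 < Real.log p := Real.log_pos hp1
  have hnp : ¬ (p ^ 2).Prime := Nat.Prime.not_prime_pow le_rfl
  have hΛ : (ArithmeticFunction.vonMangoldt (p ^ 2) : ℝ) = Real.log p := by
    rw [ArithmeticFunction.vonMangoldt_apply_pow two_ne_zero, ArithmeticFunction.vonMangoldt_apply_prime hp]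
  have hlog2 : Real.log ((p ^ 2 : ℕ) : ℝ) = 2 * Real.log p := by
    push_cast; rw [Real.log_pow]; norm_num
  -- `2 log p + 2 ≤ log x`
  have hkey : 2 * Real.log p + 2 ≤ Real.log x := by
    have h1 : Real.log (((p : ℝ) ^ 2) * Real.exp 2) ≤ Real.log x :=
      Real.log_le_log (by positivity) hpx
    rwa [Real.log_mul (by positivity) (Real.exp_pos 2).ne', Real.log_pow, Real.log_exp] at h1
  rw [gTerm, if_neg hnp, hΛ, hlog2, sub_zero]
  rw [show Real.log p / (2 * Real.log p) = 1 / 2 by field_simp]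
  rw [show (1 : ℝ) / 2 * (1 - 2 * Real.log p / Real.log x) = (Real.log x - 2 * Real.log p) / (2 * Real.log x) by
    field_simp]
  rw [inv_eq_one_div, div_le_div_iff₀ hlogx (by positivity)]
  nlinarith

/-- **`P(x) ≥ π(z)/log x`** whenever `z² e² ≤ x` (`x > 1`): keep only the prime squares `p²`,
`p ≤ z`. [cite: Robin1984Toulouse, §4 (13)] -/
theorem primeCounting_div_log_le_posPart {x : ℝ} (hx : 1 < x) {z : ℕ}
    (hz : ((z : ℝ) ^ 2) * Real.exp 2 ≤ x) :
    (Nat.primeCounting z : ℝ) / Real.log x ≤ posPart x := by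
  have hlogx : 0 < Real.log x := Real.log_pos hx
  have he : (1 : ℝ) ≤ Real.exp 2 := Real.one_le_exp (by norm_num)
  set T := (Nat.primesLE z).image fun p : ℕ => p ^ 2 with hT
  have hpz : ∀ p ∈ Nat.primesLE z, ((p : ℝ) ^ 2) * Real.exp 2 ≤ x := by
    intro p hp
    have hpz : (p : ℝ) ≤ z := by exact_mod_cast (Nat.mem_primesLE.1 hp).1
    have : (p : ℝ) ^ 2 ≤ (z : ℝ) ^ 2 := by gcongr
    nlinarith [Real.exp_pos 2]
  have hTS : T ⊆ Finset.Ioc 0 ⌊x⌋₊ := by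
    intro n hn
    obtain ⟨p, hp, rfl⟩ := Finset.mem_image.1 hn
    have hpp := (Nat.mem_primesLE.1 hp).2
    refine Finset.mem_Ioc.2 ⟨pow_pos hpp.pos 2, Nat.le_floor ?_⟩
    have h1 := hpz p hp
    push_cast
    nlinarith [Real.exp_pos 2, sq_nonneg (p : ℝ)]
  have hinj : Set.InjOn (fun p : ℕ => p ^ 2) (Nat.primesLE z : Set ℕ) :=
    fun a _ b _ h => Nat.pow_left_injective two_ne_zero h
  rw [posPart_eq_sum]
  calc (Nat.primeCounting z : ℝ) / Real.log x
      = (Nat.primesLE z).card • (Real.log x)⁻¹ := by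
        rw [Nat.primesLE_card_eq_primeCounting, nsmul_eq_mul, div_eq_mul_inv]
    _ ≤ ∑ p ∈ Nat.primesLE z, gTerm x (p ^ 2) :=
        Finset.card_nsmul_le_sum _ _ _ fun p hp =>
          inv_log_le_gTerm_sq hx (Nat.mem_primesLE.1 hp).2 (hpz p hp)
    _ = ∑ n ∈ T, gTerm x n := (Finset.sum_image hinj).symm
    _ ≤ ∑ n ∈ Finset.Ioc 0 ⌊x⌋₊, gTerm x n :=
        Finset.sum_le_sum_of_subset_of_nonneg hTS fun n hn _ => gTerm_nonneg hx hn

/-- `P(x) ≥ 0` (`x > 1`). [cite: Robin1984Toulouse, §4 (13)] -/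
theorem posPart_nonneg {x : ℝ} (hx : 1 < x) : 0 ≤ posPart x := by
  rw [posPart_eq_sum]
  exact Finset.sum_nonneg fun n hn => gTerm_nonneg hx hn

/-- **`P` under a von Koch bound**: if `|θ(y) − y| ≤ K√y log² y` for `y ≥ X ≥ 3`, then for
`x ≥ (eX)²`, `P(x) ≥ (2/log² x)(√x/e − K x^{1/4} log² x/4)` (via `P ≥ π(√x/e)/log x`,
`π(y) log y ≥ θ(y)`, `log(√x/e) = log x/2 − 1`). [cite: Robin1984Toulouse, §4 (13); Koch1901, Théorème] -/
theorem posPart_ge_of_theta {K X : ℝ} (hK : 0 < K) (hX : 3 ≤ X)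
    (hθ : ∀ y : ℝ, X ≤ y → |θ y - y| ≤ K * Real.sqrt y * Real.log y ^ 2)
    {x : ℝ} (hx : (X * Real.exp 1) ^ 2 ≤ x) :
    2 / Real.log x ^ 2 * (Real.sqrt x / Real.exp 1 - K * x ^ (1 / 4 : ℝ) * Real.log x ^ 2 / 4) ≤
      posPart x := by
  have he1 : (1 : ℝ) ≤ Real.exp 1 := Real.one_le_exp (by norm_num)
  have hX3 : (3 : ℝ) ≤ X * Real.exp 1 := by nlinarith
  have hx0 : 0 < x := lt_of_lt_of_le (by positivity) hx
  have hsx : X * Real.exp 1 ≤ Real.sqrt x := by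
    rw [Real.le_sqrt (by positivity) hx0.le]; exact hx
  set y : ℝ := Real.sqrt x / Real.exp 1 with hy
  have hyX : X ≤ y := by
    rw [hy, le_div_iff₀ (Real.exp_pos 1)]; exact hsx
  have hy3 : 3 ≤ y := hX.trans hyX
  have hy0 : 0 < y := by linarith
  have hx1 : 1 < x := by nlinarith [Real.sq_sqrt hx0.le, Real.sqrt_nonneg x]
  have hlogx : 0 < Real.log x := Real.log_pos hx1
  -- `log y = log x/2 − 1 > 0`
  have hlogy : Real.log y = Real.log x / 2 - 1 := by
    rw [hy, Real.log_div (Real.sqrt_pos.2 hx0).ne' (Real.exp_pos 1).ne', Real.log_sqrt hx0.le,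
      Real.log_exp]
  have hlogy0 : 0 < Real.log y := Real.log_pos (by linarith)
  have hly : Real.log y ≤ Real.log x / 2 := by linarith
  -- `P ≥ π(⌊y⌋)/log x`
  set z : ℕ := ⌊y⌋₊ with hz
  have hzy : (z : ℝ) ≤ y := Nat.floor_le hy0.le
  have hz2 : ((z : ℝ) ^ 2) * Real.exp 2 ≤ x := by
    have h1 : (z : ℝ) ^ 2 ≤ y ^ 2 := by gcongr
    have h2 : y ^ 2 * Real.exp 2 = x := by
      rw [hy, div_pow, Real.sq_sqrt hx0.le, show Real.exp 2 = Real.exp 1 ^ 2 by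
        rw [← Real.exp_nat_mul]; norm_num]
      field_simp
    nlinarith [Real.exp_pos 2]
  have hP := primeCounting_div_log_le_posPart hx1 hz2
  -- `π(⌊y⌋) log y ≥ θ(y) ≥ y − K√y log² y`
  have hθπ : θ y ≤ (Nat.primeCounting z : ℝ) * Real.log y := Chebyshev.theta_le_pi_mul_log' y
  have hθy : y - K * Real.sqrt y * Real.log y ^ 2 ≤ θ y := by
    have := (abs_le.1 (hθ y hyX)).1; linarith
  have hπ : (y - K * Real.sqrt y * Real.log y ^ 2) / Real.log y ≤ (Nat.primeCounting z : ℝ) := by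
    rw [div_le_iff₀ hlogy0]; linarith
  -- `√y ≤ x^{1/4}` and `log² y ≤ log² x/4`
  have hsy : Real.sqrt y ≤ x ^ (1 / 4 : ℝ) := by
    have h1 : y ≤ Real.sqrt x := by
      rw [hy, div_le_iff₀ (Real.exp_pos 1)]; nlinarith [Real.sqrt_nonneg x]
    calc Real.sqrt y ≤ Real.sqrt (Real.sqrt x) := Real.sqrt_le_sqrt h1
      _ = x ^ (1 / 4 : ℝ) := by
          rw [Real.sqrt_eq_rpow, Real.sqrt_eq_rpow, ← Real.rpow_mul hx0.le]; norm_num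
  have hly2 : Real.log y ^ 2 ≤ Real.log x ^ 2 / 4 := by nlinarith
  -- `a = K x^{1/4} log² x/4 ≥ b = K √y log² y`
  have hab : K * Real.sqrt y * Real.log y ^ 2 ≤ K * x ^ (1 / 4 : ℝ) * Real.log x ^ 2 / 4 := by
    have : Real.sqrt y * Real.log y ^ 2 ≤ x ^ (1 / 4 : ℝ) * (Real.log x ^ 2 / 4) :=
      mul_le_mul hsy hly2 (by positivity) (Real.rpow_nonneg hx0.le _)
    nlinarith
  rcases lt_or_ge (y - K * x ^ (1 / 4 : ℝ) * Real.log x ^ 2 / 4) 0 with hneg | hnn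
  · -- the claimed bound is negative, `P ≥ 0`
    have h0 : 2 / Real.log x ^ 2 * (Real.sqrt x / Real.exp 1 - K * x ^ (1 / 4 : ℝ) * Real.log x ^ 2 / 4) < 0 := by
      rw [← hy]; exact mul_neg_of_pos_of_neg (by positivity) hneg
    linarith [posPart_nonneg hx1]
  · calc 2 / Real.log x ^ 2 * (Real.sqrt x / Real.exp 1 - K * x ^ (1 / 4 : ℝ) * Real.log x ^ 2 / 4)
        = (y - K * x ^ (1 / 4 : ℝ) * Real.log x ^ 2 / 4) / (Real.log x / 2) / Real.log x := by
          rw [hy]; field_simp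
      _ ≤ (y - K * x ^ (1 / 4 : ℝ) * Real.log x ^ 2 / 4) / Real.log y / Real.log x :=
          div_le_div_of_nonneg_right (div_le_div_of_nonneg_left hnn hlogy0 hly) hlogx.le
      _ ≤ (y - K * Real.sqrt y * Real.log y ^ 2) / Real.log y / Real.log x :=
          div_le_div_of_nonneg_right (div_le_div_of_nonneg_right (by linarith) hlogy0.le) hlogx.le
      _ ≤ (Nat.primeCounting z : ℝ) / Real.log x := div_le_div_of_nonneg_right hπ hlogx.le
      _ ≤ posPart x := hP

/-! ### §6. The concavity gap under RH -/

/-- Under a von Koch bound `|θ(x) − x| ≤ K√x log² x` with `2K√x log² x ≤ x` and `x ≥ 4`: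
`gap(x) ≤ 8K² log² x` (`u = x/2 ≤ θ(x)`, `log(x/2) ≥ log x/2`). [cite: Robin1984Toulouse, §4 (13)] -/
theorem gap_le_of_theta {K X : ℝ} (hθ : ∀ y : ℝ, X ≤ y → |θ y - y| ≤ K * Real.sqrt y * Real.log y ^ 2)
    {x : ℝ} (hxX : X ≤ x) (hx4 : 4 ≤ x) (hsmall : 2 * K * Real.sqrt x * Real.log x ^ 2 ≤ x) :
    (θ x - x) / Real.log x - (logIntegral (θ x) - logIntegral x) ≤ 8 * K ^ 2 * Real.log x ^ 2 := by
  have hx0 : 0 < x := by linarith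
  have hS := hθ x hxX
  have hθx : x / 2 ≤ θ x := by have := (abs_le.1 hS).1; linarith
  have hu : (1 : ℝ) < x / 2 := by linarith
  have h := RobinLiTheta.gap_le (x := x) (y := θ x) (u := x / 2) hu (by linarith) hθx
  refine h.trans ?_
  have hlog : 0 < Real.log x := Real.log_pos (by linarith)
  have hθ2 : (θ x - x) ^ 2 ≤ (K * Real.sqrt x * Real.log x ^ 2) ^ 2 := by
    have h0 : 0 ≤ K * Real.sqrt x * Real.log x ^ 2 := by
      have := abs_nonneg (θ x - x); linarith
    exact sq_le_sq' (by linarith [(abs_le.1 hS).1]) (abs_le.1 hS).2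
  have hlog2 : Real.log x / 2 ≤ Real.log (x / 2) := by
    rw [Real.log_div hx0.ne' two_ne_zero]
    have h4 : Real.log 4 ≤ Real.log x := Real.log_le_log (by norm_num) hx4
    have : Real.log 4 = 2 * Real.log 2 := by
      rw [show (4 : ℝ) = 2 ^ 2 by norm_num, Real.log_pow]; norm_num
    linarith
  have hden : x / 2 * (Real.log x / 2) ^ 2 ≤ x / 2 * Real.log (x / 2) ^ 2 := by
    have : (Real.log x / 2) ^ 2 ≤ Real.log (x / 2) ^ 2 := pow_le_pow_left₀ (by linarith) hlog2 2
    exact mul_le_mul_of_nonneg_left this (by linarith)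
  have hst : Real.sqrt x ^ 2 = x := Real.sq_sqrt hx0.le
  calc (θ x - x) ^ 2 / (x / 2 * Real.log (x / 2) ^ 2)
      ≤ (K * Real.sqrt x * Real.log x ^ 2) ^ 2 / (x / 2 * (Real.log x / 2) ^ 2) := by
        gcongr
    _ = 8 * K ^ 2 * Real.log x ^ 2 := by
        rw [mul_pow, mul_pow, hst]
        field_simp
        ring

/-- `gap(x) ≥ 0` for `x ≥ 2` with `θ(x) > 1` (concavity of `li`). [cite: Robin1984Toulouse, §4 (13)] -/
theorem gap_nonneg {x : ℝ} (hx : 2 ≤ x) (hθ : 1 < θ x) :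
    0 ≤ (θ x - x) / Real.log x - (logIntegral (θ x) - logIntegral x) := by
  have := RobinLiTheta.logIntegral_sub_le (by linarith : (1 : ℝ) < x) hθ
  linarith

end LiThetaRH

/-! ### §7. Robin 1984, Thm. 1 -/

/-- For `p < q`, any constant `C` and any `k`: `C x^p (log x)^k ≤ x^q` for all large `x`. [folklore] -/
private theorem eventually_mul_rpow_mul_log_pow_le' (C p q : ℝ) (k : ℕ) (hpq : p < q) :
    ∀ᶠ x : ℝ in atTop, C * x ^ p * Real.log x ^ k ≤ x ^ q := by
  have h1 : (fun x : ℝ ↦ Real.log x ^ (k : ℝ)) =o[atTop] fun x ↦ x ^ (q - p) :=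
    isLittleO_log_rpow_rpow_atTop (k : ℝ) (by linarith)
  have h2 : ∀ᶠ x : ℝ in atTop, ‖Real.log x ^ (k : ℝ)‖ ≤ 1 / (|C| + 1) * ‖x ^ (q - p)‖ :=
    h1.bound (by positivity)
  filter_upwards [h2, eventually_ge_atTop (1 : ℝ)] with x hx hx1
  have hx0 : 0 < x := by linarith
  have hlog : 0 ≤ Real.log x := Real.log_nonneg hx1
  rw [Real.rpow_natCast, Real.norm_of_nonneg (pow_nonneg hlog _),
    Real.norm_of_nonneg (Real.rpow_nonneg hx0.le _)] at hx
  have hC : C ≤ |C| := le_abs_self C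
  have hC0 : 0 ≤ |C| := abs_nonneg C
  have hxp : 0 ≤ x ^ p := Real.rpow_nonneg hx0.le _
  have hlk : 0 ≤ Real.log x ^ k := pow_nonneg hlog _
  have hsplit : x ^ q = x ^ p * x ^ (q - p) := by
    rw [← Real.rpow_add hx0]; congr 1; ring
  have hfrac : |C| * (1 / (|C| + 1)) ≤ 1 := by
    rw [← mul_div_assoc, mul_one, div_le_one (by positivity)]; linarith
  calc C * x ^ p * Real.log x ^ k ≤ |C| * x ^ p * Real.log x ^ k :=
        mul_le_mul_of_nonneg_right (mul_le_mul_of_nonneg_right hC hxp) hlk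
    _ ≤ |C| * x ^ p * (1 / (|C| + 1) * x ^ (q - p)) :=
        mul_le_mul_of_nonneg_left hx (mul_nonneg hC0 hxp)
    _ = (|C| * (1 / (|C| + 1))) * (x ^ p * x ^ (q - p)) := by ring
    _ ≤ 1 * (x ^ p * x ^ (q - p)) :=
        mul_le_mul_of_nonneg_right hfrac (mul_nonneg hxp (Real.rpow_nonneg hx0.le _))
    _ = x ^ q := by rw [one_mul, hsplit]

/-- **Robin 1984, Thm. 1, `⟹` half: under RH, `A(x) = li(θ(x)) − π(x) > 0` for all large `x`**
("Lorsque l'hypothèse de Riemann est vraie … `A(x) > 0`, pour `x` assez grand"); quantitatively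
`A(x) ≥ 0.52 √x/log² x − O(x^{1/4}) − O(log² x) − O(1)`. RH-CONDITIONAL (an implication from RH;
nothing asserted about RH). [cite: Robin1984Toulouse, Thm. 1; Nicolas2017, Thm. 1.1 (1.7)] -/
theorem eventually_liThetaSubPi_pos_of_riemannHypothesis (hRH : RiemannHypothesis) :
    ∀ᶠ x : ℝ in atTop, 0 < liThetaSubPi x := by
  obtain ⟨x₁, C, hx₁, hD⟩ := LiThetaRH.abs_robinD_le_of_RH hRH
  obtain ⟨K, X, hK, hX, hθ⟩ := LiThetaRH.exists_abs_theta_sub_le_of_RH hRH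
  -- the lower-order terms are eventually `≤ 0.01 √x/log² x` each, and `2K√x log² x ≤ x`
  have hE1 : ∀ᶠ x : ℝ in atTop, 100 * (C + |logIntegral 2|) * x ^ (0 : ℝ) * Real.log x ^ 2 ≤
      x ^ (1 / 2 : ℝ) := eventually_mul_rpow_mul_log_pow_le' _ 0 (1 / 2) 2 (by norm_num)
  have hE2 : ∀ᶠ x : ℝ in atTop, 50 * K * x ^ (1 / 4 : ℝ) * Real.log x ^ 2 ≤ x ^ (1 / 2 : ℝ) :=
    eventually_mul_rpow_mul_log_pow_le' _ (1 / 4) (1 / 2) 2 (by norm_num)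
  have hE3 : ∀ᶠ x : ℝ in atTop, 800 * K ^ 2 * x ^ (0 : ℝ) * Real.log x ^ 4 ≤ x ^ (1 / 2 : ℝ) :=
    eventually_mul_rpow_mul_log_pow_le' _ 0 (1 / 2) 4 (by norm_num)
  have hE4 : ∀ᶠ x : ℝ in atTop, 2 * K * x ^ (1 / 2 : ℝ) * Real.log x ^ 2 ≤ x ^ (1 : ℝ) :=
    eventually_mul_rpow_mul_log_pow_le' _ (1 / 2) 1 2 (by norm_num)
  have he1 : (1 : ℝ) ≤ Real.exp 1 := Real.one_le_exp (by norm_num)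
  filter_upwards [hE1, hE2, hE3, hE4, eventually_ge_atTop (max (max x₁ 4) (max X ((X * Real.exp 1) ^ 2)))]
    with x h1 h2 h3 h4 hx
  have hxx₁ : x₁ ≤ x := le_trans (le_max_left _ _) ((le_max_left _ _).trans hx)
  have hx4 : (4 : ℝ) ≤ x := le_trans (le_max_right _ _) ((le_max_left _ _).trans hx)
  have hxX : X ≤ x := le_trans (le_max_left _ _) ((le_max_right _ _).trans hx)
  have hx5 : (X * Real.exp 1) ^ 2 ≤ x := le_trans (le_max_right _ _) ((le_max_right _ _).trans hx)
  have hx2 : (2 : ℝ) ≤ x := by linarith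
  have hx0 : 0 < x := by linarith
  have hlog : 0 < Real.log x := Real.log_pos (by linarith)
  have hL2 : 0 < Real.log x ^ 2 := pow_pos hlog 2
  have hs0 : 0 < Real.sqrt x := Real.sqrt_pos.2 hx0
  have hsx : x ^ (1 / 2 : ℝ) = Real.sqrt x := (Real.sqrt_eq_rpow x).symm
  rw [Real.rpow_zero, mul_one] at h1 h3
  rw [hsx] at h1 h2 h3 h4
  rw [Real.rpow_one] at h4
  -- the pieces
  have hDx := (abs_le.1 (hD x hxx₁)).1
  have hP := LiThetaRH.posPart_ge_of_theta hK hX hθ hx5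
  have hG := LiThetaRH.gap_le_of_theta hθ hxX hx4 (by linarith)
  rw [LiThetaRH.liThetaSubPi_eq_posPart hx2]
  set s : ℝ := Real.sqrt x / Real.log x ^ 2 with hs
  have hs_pos : 0 < s := by positivity
  -- the main term of `P`: `(2/log² x)(√x/e − K x^{1/4} log² x/4) = (2/e) s − K x^{1/4}/2`
  have hPexp : 2 / Real.log x ^ 2 * (Real.sqrt x / Real.exp 1 - K * x ^ (1 / 4 : ℝ) * Real.log x ^ 2 / 4) =
      2 / Real.exp 1 * s - K * x ^ (1 / 4 : ℝ) / 2 := by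
    rw [hs]
    field_simp
    ring
  have he : 0.735 * s ≤ 2 / Real.exp 1 * s := by
    refine mul_le_mul_of_nonneg_right ?_ hs_pos.le
    rw [le_div_iff₀ (Real.exp_pos 1)]
    nlinarith [Real.exp_one_lt_d9]
  -- the three small terms are `≤ 0.01 s`
  have hb1 : C + |logIntegral 2| ≤ 0.01 * s := by
    rw [hs, mul_div_assoc', le_div_iff₀ hL2]
    linarith
  have hb2 : K * x ^ (1 / 4 : ℝ) / 2 ≤ 0.01 * s := by
    rw [hs, mul_div_assoc', le_div_iff₀ hL2]
    have e : K * x ^ (1 / 4 : ℝ) / 2 * Real.log x ^ 2 =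
        (1 / 100) * (50 * K * x ^ (1 / 4 : ℝ) * Real.log x ^ 2) := by ring
    rw [e]
    linarith
  have hb3 : 8 * K ^ 2 * Real.log x ^ 2 ≤ 0.01 * s := by
    rw [hs, mul_div_assoc', le_div_iff₀ hL2]
    have e : 8 * K ^ 2 * Real.log x ^ 2 * Real.log x ^ 2 =
        (1 / 100) * (800 * K ^ 2 * Real.log x ^ 4) := by ring
    rw [e]
    linarith
  have hli : -|logIntegral 2| ≤ logIntegral 2 := neg_abs_le _
  rw [hPexp] at hP
  linarith

/-- **Robin 1984, Thm. 1** ("L'assertion `A(x) = Li(θ(x)) − π(x) > 0` pour `x` assez grand est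
équivalente à l'hypothèse de Riemann"), now PROVED in both directions: `⟹` is
`eventually_liThetaSubPi_pos_of_riemannHypothesis`, `⟸` the tree's
`riemannHypothesis_of_eventually_liThetaSubPi_pos` (Robin's Lemma 2). RH-EQUIVALENT (an
equivalence; neither side asserted). [cite: Robin1984Toulouse, Thm. 1; Nicolas2017, Cor. 1.1] -/
theorem riemannHypothesis_iff_eventually_liThetaSubPi_pos :
    RiemannHypothesis ↔ ∀ᶠ x : ℝ in atTop, 0 < liThetaSubPi x :=
  ⟨eventually_liThetaSubPi_pos_of_riemannHypothesis, riemannHypothesis_of_eventually_liThetaSubPi_pos⟩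

end Literature.NumberTheory.LFunctions

end
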